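import Summits.BirchSwinnertonDyer.BirchSwinnertonDyer.Theorems.KolyvaginRoadThreeMethod2BipartiteDefiniteColumn
import Summits.BirchSwinnertonDyer.BirchSwinnertonDyer.Theorems.KolyvaginRoadThreeMethod2CruxOfBipartite
import HarnessLib

/-!
# Route `KolyvaginRoadThree`, crux `ZhangSharpFrameAtThreeHL` (item stmt-BirchSwinnertonDyer-19574): THE METHOD LINE'S TERMINAL
# STATE IN BIPARTITE CURRENCY WITH THE DEFINITE CONDUCTOR-ONE COLUMN OVER REAL OBJECTS — the crux BY NAME from the route's two
# published-input binders, the abstract INDEFINITE datum (+ derived definite values), and FOUR statements over the tree's Brandt modules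
# (cell `bsd-stepL`, seat `bsd-stepL-zhang3-w2` g0; `--supports stmt-BirchSwinnertonDyer-19574`, helper; assembles p683698 (definite column) +
# p683235's pattern with koly3b g10's terminal certificate `PTAt.zhangSharpFrameAtThreeHL_of_routeBinders_of_bottom_of_levelSystems'`)

WHAT. `zhangSharpFrameAtThreeHL_of_routeBinders_of_bipartite` (p683235) gave the crux BY NAME from `h₁ + hCT3` and ONE hypothesis «a mod-3
bipartite datum with anchor at every HL A1 frame», all of whose DEFINITE side was abstract (`λ(m, n′) ∈ 𝔽₃`). `…BipartiteDefiniteColumn`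
(p683698) typed the CONDUCTOR-ONE column of the definite side over REAL objects (koly g16's `IsModThreeEigenline`, `grossPeriod` on
`Brandt.XiSetup N (∏n′)`). THIS FILE puts the two together:

* `kolyvaginClass_one_ne_zero_of_definiteColumnFirstFloor` — S1's conclusion at `dim_𝔽₃ Sel₃(E/K) = 1` from the FIRST FLOOR of the concrete
  column: `realisation` at `m = ∅`, (A1) at `∅` (binder), (DLR∀) ∕ (V∀) at the one-prime levels and (J∀) at `n = ∅` — W. Zhang's proof of
  Thm 7.2 for `(N, 1)` read over the Brandt module (koly g16's `kolyvaginClass_one_ne_zero_of_definiteFirstFloor` in the all-levels binder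
  shapes, for the realised datum).
* `zhangSharpFrameAtThreeHL_of_routeBinders_of_bipartite_definiteColumn` — **the crux BY NAME from `h₁ : PublishedInputsKolyThree`,
  `hCT3 : ShimuraCasselsTateLevelInputs` and ONE hypothesis `hBES`: at every HL A1 frame, for every complex conjugation `c ≠ 1` and the
  `ZMod 3`-structure, there EXIST signs `ε₀`, even-level classes `κ₀` and derived definite values `λ′` with (I) the INDEFINITE datum —
  `realisation`, `sign`, `selmer_off`, `ordinary_on`, `transverse_on`, `relation` at even good levels — (II) the DERIVED definite columns
  `m ≠ ∅` — (A⇐)′ ∕ (B⇒)′ — and (III) the CONDUCTOR-ONE definite column OVER REAL OBJECTS — (DLR∀) a Brandt setup of discriminant `∏n′` with a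
  conductor-1 Gross point and a mod-3 eigenline of `E` at every odd good level, (J∀) the Jochnowitz readings, (B∅∀) the first reciprocity law
  at `m = ∅` on the period, (V∀) the unit Gross period at canonical rank zero.** (I)+(II) have no typed object in the tree (Shimura curves
  `X_{N,∏n}`, CM points, derived Gross divisors); (III) is stated over `Literature/NumberTheory/Automorphic/BrandtXi` +
  `Literature/NumberTheory/EllipticCurves/GrossPoints` and is, level by level, [Z14] Thm 2.1 + (4.8) (DLR∀), (4.3) + (4.9) + Thm 3.1 (J∀),
  (4.4)–(4.5) (B∅∀), Thm 7.1 + Cor 6.2 + Thm 6.4 (V∀) RUN AT `p = 3` — the card's bricks R2 ∕ R6 ∕ R7 on the definite side; the E-side of the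
  line is entirely discharged ((A1) stub A, stub P from `h₁ + hCT3`, S2-ENGINE, `selmer_inf`, odd levels, `transport`, `baseCase`).

HONEST FRAMING: theorems only; 0 definitions, 0 named facts, 0 `sorry`; CONDITIONAL — `h₁`, `hCT3` (published inputs) and `hBES` (NOT in print
at `p = 3`; the crux's residual content, now split into abstract indefinite ∕ derived parts and four concrete definite statements) are
HYPOTHESES; THE PIN of koly g16's anemic `IsModThreeEigenline` applies (off the conductor-exactly-`N` locus (DLR∀) is uninhabited and `hBES`
unsatisfiable as typed — there `U`-operators are wanted); closes nothing (T7): the crux is NOT proved by this. This module imports the route file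
(through the terminal certificate) by necessity. PARTITION: O2@3 (B10) × A1 × crux 19574 — proves-glue. BSD is not proved by any of this.

References: [cite: WZhang2014, Thm. 2.1, Thm. 3.1, (4.3)–(4.5), (4.8)–(4.9), Cor. 6.2, Thm. 6.4, Thm. 7.1, Thm. 7.2, §9, Thm. 9.2]
[cite: BertoliniDarmon2005, Thm. 4.1, Thm. 4.2, Thm. 9.2] [cite: BertoliniDarmon1996, §2.1, §2.5] [cite: GrossLMS1991, Prop. 2.3].
-/

noncomputable section

open scoped Classical

namespace Summit.BirchSwinnertonDyer.Rank1Residual.X11b.Three.Koly.Method2Bipartite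

open WeierstrassCurve NumberField IsDedekindDomain
  Literature.NumberTheory.EllipticCurves Literature.NumberTheory.EllipticCurves.ModularForms
  Literature.NumberTheory.GaloisRepresentations Literature.NumberTheory.Automorphic Module

open Summit.BirchSwinnertonDyer.Rank1Residual.X11b.Three.Koly.Method2
open Summit.BirchSwinnertonDyer.Rank1Residual.X11b.Three.Koly.Method2DefiniteFirstFloor

section FirstFloor

variable (W : WeierstrassCurve ℚ) (K : Type) [Field K] [NumberField K]
  [W.IsElliptic] [W.IsGloballyMinimal] [NeZero (W.conductorNorm ℤ)]
  (Dt : ModularParametrizationData W (W.conductorNorm ℤ)) (β : ℤ) (ι : K →+* ℂ) (c : K ≃ₐ[ℚ] K)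
  [Module (ZMod 3) (V3 W K)]

/-- **THE FIRST FLOOR OVER THE BRANDT MODULE, in the all-levels binder shapes: `c(1) ≢ 0 (mod 3)` at `dim_𝔽₃ Sel₃(E/K) = 1`.** Let `K` be
imaginary quadratic, `c` an involution, `dim_𝔽₃ Sel₃(E/K) = 1`. GIVEN bottom classes `κ₀(·, ∅)` with `realisation`, (A1) on good levels
(binder), and at the ONE-PRIME levels: (DLR∀) a definite datum, (V∀) the unit value at rank zero, and (J∀) at `n = ∅` the Jochnowitz reading
of `κ₀(∅, ∅)` — THEN some conductor-1 Kolyvagin–Heegner datum of the frame has non-zero Kolyvagin class mod 3. Proof (Zhang, pp. 232–233):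
the Selmer line `Sel_∅^μ = 𝔽₃ x` dies at a good `q` ((A1)), so `SelQ {q} ± = ⊥`; (DLR∀) at `{q}` gives `(S, x₀, φ)`; (V∀) makes
`3 ∤ grossPeriod`; (J∀) at `(∅, q)` then detects `κ₀(∅, ∅) = c_d(1)` above `q`. [cite: WZhang2014, Thm. 7.2 (proof pp. 232–233), Thm. 7.1,
(4.9), Cor. 6.2] -/
theorem kolyvaginClass_one_ne_zero_of_definiteColumnFirstFloor (hK : IsImaginaryQuadratic K) (hcc : c * c = 1)
    {κ₀ : Finset {ℓ // Zhang2014.IsKolyvaginPrime (W.conductorNorm ℤ) W K 3 ℓ} →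
      Finset {q // IsUAdmissiblePrime W K q} → V3 W K}
    (realisation : ∀ m : Finset {ℓ // Zhang2014.IsKolyvaginPrime (W.conductorNorm ℤ) W K 3 ℓ},
      ∃ d : KolyvaginHeegnerData Dt β ι (∏ ℓ ∈ m, (ℓ : ℕ)), κ₀ m ∅ = d.kolyvaginClass Nat.prime_three 1)
    (hA1 : ∀ (n : Finset {q // IsUAdmissiblePrime W K q}) (μ : Bool) (x : V3 W K),
      GoodLevel W K n → x ∈ SelQ W K c n μ → x ≠ 0 →
      ∃ q : {q // IsUAdmissiblePrime W K q}, q ∉ n ∧ GoodLevel W K (insert q n) ∧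
        x ∉ SelQ W K c (insert q n) μ ∧
        SelQ W K c (insert q n) μ ≤ SelQ W K c n μ ∧
        finrank (ZMod 3) (SelQ W K c (insert q n) μ) + 1 = finrank (ZMod 3) (SelQ W K c n μ) ∧
        SelQ W K c (insert q n) (!μ) = SelQ W K c n (!μ))
    (hDLR : ∀ n' : Finset {q // IsUAdmissiblePrime W K q}, GoodLevel W K n' → Odd n'.card →
      ∃ (S : Brandt.XiSetup (W.conductorNorm ℤ) (∏ q ∈ n', (q : ℕ))) (_ : Fintype (Brandt.ClassSet S.O))
        (x₀ : GrossSpace S.D K) (φ : Brandt.ClassSet S.O → ℤ), x₀ ∈ grossPoints K S 1 ∧ IsModThreeEigenline W S φ)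
    (hJ : ∀ (n : Finset {q // IsUAdmissiblePrime W K q}) (q : {q // IsUAdmissiblePrime W K q}),
      GoodLevel W K (insert q n) → Even n.card → q ∉ n →
      ∀ (S : Brandt.XiSetup (W.conductorNorm ℤ) (∏ q' ∈ insert q n, (q' : ℕ))) [Fintype (Brandt.ClassSet S.O)]
        (x₀ : GrossSpace S.D K) (φ : Brandt.ClassSet S.O → ℤ), x₀ ∈ grossPoints K S 1 → IsModThreeEigenline W S φ →
      ∀ v : HeightOneSpectrum (𝓞 K), ((q : ℕ) : 𝓞 K) ∈ v.asIdeal →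
      (κ₀ ∅ n ∈ (W.baseChange K).torsionLocalKer (v.adicCompletion K) ((3 ^ 1 : ℕ) : ℤ) ↔
        (3 : ℤ) ∣ grossPeriod K S φ x₀))
    (hV : ∀ n' : Finset {q // IsUAdmissiblePrime W K q}, GoodLevel W K n' → Odd n'.card →
      ∀ (S : Brandt.XiSetup (W.conductorNorm ℤ) (∏ q ∈ n', (q : ℕ))) [Fintype (Brandt.ClassSet S.O)]
        (x₀ : GrossSpace S.D K) (φ : Brandt.ClassSet S.O → ℤ), x₀ ∈ grossPoints K S 1 → IsModThreeEigenline W S φ →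
      SelQ W K c n' true = ⊥ → SelQ W K c n' false = ⊥ → ¬ (3 : ℤ) ∣ grossPeriod K S φ x₀)
    (h1 : finrank (ZMod 3)
      (AddSubgroup.toZModSubmodule 3 (selmerGroup (W.baseChange K) ((3 ^ 1 : ℕ) : ℤ))) = 1) :
    ∃ d : KolyvaginHeegnerData Dt β ι 1, d.kolyvaginClass Nat.prime_three 1 ≠ 0 := by
  -- the Selmer line and its sign
  rw [finrank_selmer_eq_finrank_selQ_add W K hK c hcc] at h1
  obtain ⟨μ, hμ1, hμ0⟩ : ∃ μ : Bool, finrank (ZMod 3) (SelQ W K c ∅ μ) = 1 ∧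
      finrank (ZMod 3) (SelQ W K c ∅ (!μ)) = 0 := by
    rcases Nat.eq_zero_or_pos (finrank (ZMod 3) (SelQ W K c ∅ true)) with h0 | hpos
    · exact ⟨false, by omega, h0⟩
    · exact ⟨true, by omega, by change finrank (ZMod 3) (SelQ W K c ∅ false) = 0; omega⟩
  have hne : SelQ W K c ∅ μ ≠ ⊥ := by
    intro h
    rw [h, finrank_bot] at hμ1
    exact zero_ne_one hμ1
  obtain ⟨x, hx, hx0⟩ := Submodule.exists_mem_ne_zero_of_ne_bot hne
  -- (A1) at the empty level kills `x` at a good unipotent-admissible prime `q`; the level `{q}` has total canonical rank zero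
  obtain ⟨q, hq0, hgood, -, -, hrank, hother⟩ := hA1 ∅ μ x (goodLevel_empty W K) hx hx0
  haveI := finiteDimensional_selQ W K c (insert q ∅) μ
  haveI := finiteDimensional_selQ W K c (insert q ∅) (!μ)
  have hq1 : SelQ W K c (insert q ∅) μ = ⊥ := Submodule.finrank_eq_zero.mp (by omega)
  have hq2 : SelQ W K c (insert q ∅) (!μ) = ⊥ := Submodule.finrank_eq_zero.mp (by rw [hother]; exact hμ0)
  have ht : SelQ W K c (insert q ∅) true = ⊥ := by cases μ <;> assumption
  have hf : SelQ W K c (insert q ∅) false = ⊥ := by cases μ <;> assumption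
  -- the definite first floor at `{q}`
  have hodd : Odd (insert q (∅ : Finset {q // IsUAdmissiblePrime W K q})).card := by simp
  obtain ⟨S, inst, x₀, φ, hx₀, hφ⟩ := hDLR (insert q ∅) hgood hodd
  have hVq : ¬ (3 : ℤ) ∣ grossPeriod K S φ x₀ := hV (insert q ∅) hgood hodd S x₀ φ hx₀ hφ ht hf
  obtain ⟨v, hv⟩ := exists_place_above W K q
  have hdet : κ₀ ∅ ∅ ∉ (W.baseChange K).torsionLocalKer (v.adicCompletion K) ((3 ^ 1 : ℕ) : ℤ) :=
    fun hmem ↦ hVq ((hJ ∅ q hgood (by simp) hq0 S x₀ φ hx₀ hφ v hv).mp hmem)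
  -- `realisation` at `m = ∅`: the bottom class IS `c_d(1)`
  obtain ⟨d, hd⟩ := realisation ∅
  simp only [Finset.prod_empty] at d hd
  exact ⟨d, hd ▸ ne_zero_of_not_mem_torsionLocalKer W K hdet⟩

end FirstFloor

/-- **THE METHOD LINE'S TERMINAL STATE, DEFINITE CONDUCTOR-ONE COLUMN CONCRETE: the crux `ZhangSharpFrameAtThreeHL` BY NAME from the route's
published-input binders `h₁`, `hCT3` and ONE hypothesis `hBES` = at every HL A1 frame, for every `c ≠ 1` and the `ZMod 3`-structure, there
EXIST `ε₀`, `κ₀`, `λ′` with (I) the abstract INDEFINITE datum (`realisation`, five local axioms at even good levels), (II) the laws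
(A⇐)′ ∕ (B⇒)′ for the DERIVED columns `m ≠ ∅`, (III) over REAL Brandt objects at every odd good level: (DLR∀), (J∀), (B∅∀), (V∀).**
Proof: S1's text by `kolyvaginClass_one_ne_zero_of_definiteColumnFirstFloor` ((A1) = stub A, `c² = 1` by `algEquiv_mul_self_eq_one`), S2-KS's
text by `stub_levelKolyvaginSystemsAtThree_of_bipartite_definiteColumn` (p683698), then koly3b g10's terminal certificate. `hBES` is NOT
asserted. [cite: WZhang2014, Thm. 2.1, Thm. 3.1, (4.3)–(4.5), (4.8)–(4.9), Cor. 6.2, Thm. 6.4, Thm. 7.1, Thm. 7.2, §9, Thm. 9.2]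
[cite: BertoliniDarmon2005, Thm. 4.1, Thm. 4.2] [cite: GrossLMS1991, Prop. 2.3] -/
theorem zhangSharpFrameAtThreeHL_of_routeBinders_of_bipartite_definiteColumn
    (h₁ : Summit.BirchSwinnertonDyer.BirchSwinnertonDyer.Theses.KolyvaginRoadThree.PublishedInputsKolyThree)
    (hCT3 : Summit.BirchSwinnertonDyer.BirchSwinnertonDyer.Theses.KolyvaginRoadThree.ShimuraCasselsTateLevelInputs)
    (hBES :
      ∀ (W : WeierstrassCurve ℚ) [W.IsElliptic] [W.IsGloballyMinimal] [NeZero (W.conductorNorm ℤ)] (K : Type)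
        [Field K] [NumberField K] (Dt : ModularParametrizationData W (W.conductorNorm ℤ)) (β : ℤ) (ι : K →+* ℂ),
        Summit.BirchSwinnertonDyer.Rank1Residual.ClassX11b W 3 → W.HasMultiplicativeReductionAtPrime 3 →
        Rank1Residual.Surj W 3 → Rank1Residual.Ram W 3 → ¬ 3 ∣ W.tamagawaProduct → IsImaginaryQuadratic K →
        Odd (NumberField.discr K) → SatisfiesHeegnerHypothesis (W.conductorNorm ℤ) K →
        (W.quadraticTwist (NumberField.discr K : ℚ)).entireLFunction 1 ≠ 0 → NumberField.discr K ≠ -3 →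
        (4 * (W.conductorNorm ℤ : ℤ)) ∣ β ^ 2 - NumberField.discr K → ¬ (3 : ℤ) ∣ Dt.c →
        ∀ (c : K ≃ₐ[ℚ] K), c ≠ 1 → ∀ [Module (ZMod 3) (V3 W K)],
        ∃ (ε₀ : Finset {q // IsUAdmissiblePrime W K q} → Bool)
          (κ₀ : Finset {ℓ // Zhang2014.IsKolyvaginPrime (W.conductorNorm ℤ) W K 3 ℓ} →
            Finset {q // IsUAdmissiblePrime W K q} → V3 W K)
          (lam' : Finset {ℓ // Zhang2014.IsKolyvaginPrime (W.conductorNorm ℤ) W K 3 ℓ} →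
            Finset {q // IsUAdmissiblePrime W K q} → ZMod 3),
        -- (I) the INDEFINITE datum: realisation at `∅` and the five local axioms at even good non-empty levels
        (∀ m : Finset {ℓ // Zhang2014.IsKolyvaginPrime (W.conductorNorm ℤ) W K 3 ℓ},
          ∃ d : KolyvaginHeegnerData Dt β ι (∏ ℓ ∈ m, (ℓ : ℕ)), κ₀ m ∅ = d.kolyvaginClass Nat.prime_three 1) ∧
        (∀ n, GoodLevel W K n → n.Nonempty → Even n.card →
          ∀ m : Finset {ℓ // Zhang2014.IsKolyvaginPrime (W.conductorNorm ℤ) W K 3 ℓ},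
          conjAct W c ((3 ^ 1 : ℕ) : ℤ) (κ₀ m n) = sgn (ε₀ n ^^ Nat.bodd m.card) • κ₀ m n) ∧
        (∀ n, GoodLevel W K n → n.Nonempty → Even n.card →
          ∀ (m : Finset {ℓ // Zhang2014.IsKolyvaginPrime (W.conductorNorm ℤ) W K 3 ℓ}) (v : HeightOneSpectrum (𝓞 K)),
          (∀ ℓ ∈ m, ((ℓ : ℕ) : 𝓞 K) ∉ v.asIdeal) → (∀ q ∈ n, ((q : ℕ) : 𝓞 K) ∉ v.asIdeal) →
          κ₀ m n ∈ selmerLocalKer (W.baseChange K) (v.adicCompletion K) ((3 ^ 1 : ℕ) : ℤ)) ∧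
        (∀ n, GoodLevel W K n → n.Nonempty → Even n.card →
          ∀ m : Finset {ℓ // Zhang2014.IsKolyvaginPrime (W.conductorNorm ℤ) W K 3 ℓ}, ∀ q ∈ n,
          ∀ v : HeightOneSpectrum (𝓞 K), ((q : ℕ) : 𝓞 K) ∈ v.asIdeal →
          κ₀ m n ∈ (W.baseChange K).ordinaryLocalKer (v.adicCompletion K) ((3 ^ 1 : ℕ) : ℤ)) ∧
        (∀ n, GoodLevel W K n → n.Nonempty → Even n.card →
          ∀ m : Finset {ℓ // Zhang2014.IsKolyvaginPrime (W.conductorNorm ℤ) W K 3 ℓ}, ∀ ℓ ∈ m,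
          ∀ v : HeightOneSpectrum (𝓞 K), ((ℓ : ℕ) : 𝓞 K) ∈ v.asIdeal → κ₀ m n ∈ transverseLocalKer W K ι ℓ v) ∧
        (∀ n, GoodLevel W K n → n.Nonempty → Even n.card →
          ∀ (m : Finset {ℓ // Zhang2014.IsKolyvaginPrime (W.conductorNorm ℤ) W K 3 ℓ})
            (ℓ : {ℓ // Zhang2014.IsKolyvaginPrime (W.conductorNorm ℤ) W K 3 ℓ}), ℓ ∉ m → ∀ v : HeightOneSpectrum (𝓞 K),
          ((ℓ : ℕ) : 𝓞 K) ∈ v.asIdeal →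
          (κ₀ (insert ℓ m) n ∈ (W.baseChange K).torsionLocalKer (v.adicCompletion K) ((3 ^ 1 : ℕ) : ℤ) ↔
            κ₀ m n ∈ (W.baseChange K).torsionLocalKer (v.adicCompletion K) ((3 ^ 1 : ℕ) : ℤ))) ∧
        -- (II) the DERIVED definite columns `m ≠ ∅`: (A⇐)′ and (B⇒)′
        (∀ (n : Finset {q // IsUAdmissiblePrime W K q}) (q : {q // IsUAdmissiblePrime W K q}),
          GoodLevel W K (insert q n) → Even n.card → q ∉ n →
          ∀ m : Finset {ℓ // Zhang2014.IsKolyvaginPrime (W.conductorNorm ℤ) W K 3 ℓ}, m.Nonempty →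
          lam' m (insert q n) ≠ 0 → ∃ v : HeightOneSpectrum (𝓞 K), ((q : ℕ) : 𝓞 K) ∈ v.asIdeal ∧
            κ₀ m n ∉ (W.baseChange K).torsionLocalKer (v.adicCompletion K) ((3 ^ 1 : ℕ) : ℤ)) ∧
        (∀ (n : Finset {q // IsUAdmissiblePrime W K q}) (q : {q // IsUAdmissiblePrime W K q}),
          GoodLevel W K (insert q n) → Odd n.card → q ∉ n →
          ∀ (m : Finset {ℓ // Zhang2014.IsKolyvaginPrime (W.conductorNorm ℤ) W K 3 ℓ}), m.Nonempty →
          ∀ (v : HeightOneSpectrum (𝓞 K)), ((q : ℕ) : 𝓞 K) ∈ v.asIdeal →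
          κ₀ m (insert q n) ∉ (W.baseChange K).torsionLocalKer (v.adicCompletion K) ((3 ^ 1 : ℕ) : ℤ) →
          lam' m n ≠ 0) ∧
        -- (III) the CONDUCTOR-ONE definite column over Brandt objects: (DLR∀), (J∀), (B∅∀), (V∀)
        (∀ n' : Finset {q // IsUAdmissiblePrime W K q}, GoodLevel W K n' → Odd n'.card →
          ∃ (S : Brandt.XiSetup (W.conductorNorm ℤ) (∏ q ∈ n', (q : ℕ))) (_ : Fintype (Brandt.ClassSet S.O))
            (x₀ : GrossSpace S.D K) (φ : Brandt.ClassSet S.O → ℤ), x₀ ∈ grossPoints K S 1 ∧ IsModThreeEigenline W S φ) ∧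
        (∀ (n : Finset {q // IsUAdmissiblePrime W K q}) (q : {q // IsUAdmissiblePrime W K q}),
          GoodLevel W K (insert q n) → Even n.card → q ∉ n →
          ∀ (S : Brandt.XiSetup (W.conductorNorm ℤ) (∏ q' ∈ insert q n, (q' : ℕ))) [Fintype (Brandt.ClassSet S.O)]
            (x₀ : GrossSpace S.D K) (φ : Brandt.ClassSet S.O → ℤ), x₀ ∈ grossPoints K S 1 → IsModThreeEigenline W S φ →
          ∀ v : HeightOneSpectrum (𝓞 K), ((q : ℕ) : 𝓞 K) ∈ v.asIdeal →
          (κ₀ ∅ n ∈ (W.baseChange K).torsionLocalKer (v.adicCompletion K) ((3 ^ 1 : ℕ) : ℤ) ↔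
            (3 : ℤ) ∣ grossPeriod K S φ x₀)) ∧
        (∀ (n' : Finset {q // IsUAdmissiblePrime W K q}) (q : {q // IsUAdmissiblePrime W K q}),
          GoodLevel W K (insert q n') → Odd n'.card → q ∉ n' →
          ∀ (S : Brandt.XiSetup (W.conductorNorm ℤ) (∏ q' ∈ n', (q' : ℕ))) [Fintype (Brandt.ClassSet S.O)]
            (x₀ : GrossSpace S.D K) (φ : Brandt.ClassSet S.O → ℤ), x₀ ∈ grossPoints K S 1 → IsModThreeEigenline W S φ →
          ∀ v : HeightOneSpectrum (𝓞 K), ((q : ℕ) : 𝓞 K) ∈ v.asIdeal →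
          κ₀ ∅ (insert q n') ∉ (W.baseChange K).torsionLocalKer (v.adicCompletion K) ((3 ^ 1 : ℕ) : ℤ) →
          ¬ (3 : ℤ) ∣ grossPeriod K S φ x₀) ∧
        (∀ n' : Finset {q // IsUAdmissiblePrime W K q}, GoodLevel W K n' → Odd n'.card →
          ∀ (S : Brandt.XiSetup (W.conductorNorm ℤ) (∏ q ∈ n', (q : ℕ))) [Fintype (Brandt.ClassSet S.O)]
            (x₀ : GrossSpace S.D K) (φ : Brandt.ClassSet S.O → ℤ), x₀ ∈ grossPoints K S 1 → IsModThreeEigenline W S φ →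
          SelQ W K c n' true = ⊥ → SelQ W K c n' false = ⊥ → ¬ (3 : ℤ) ∣ grossPeriod K S φ x₀)) :
    Summit.BirchSwinnertonDyer.BirchSwinnertonDyer.Theses.KolyvaginRoadThree.ZhangSharpFrameAtThreeHL := by
  refine PTAt.zhangSharpFrameAtThreeHL_of_routeBinders_of_bottom_of_levelSystems' h₁ hCT3 ?_ ?_
  · -- S1: at `dim = 1`, choose `c ≠ 1`, take the datum at `c`, read its definite first floor
    intro W _ _ _ K _ _ Dt β ι hX hmult hsurj hram htam hK hodd hH hLt h3 hβ hc _ h1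
    obtain ⟨c, hc1⟩ : ∃ c : K ≃ₐ[ℚ] K, c ≠ 1 := by
      haveI : Algebra.IsQuadraticExtension ℚ K := ⟨hK.1⟩
      have hcard : Nat.card (K ≃ₐ[ℚ] K) = 2 := by rw [IsGalois.card_aut_eq_finrank, hK.1]
      haveI : Finite (K ≃ₐ[ℚ] K) := Nat.finite_of_card_ne_zero (by rw [hcard]; decide)
      haveI : Nontrivial (K ≃ₐ[ℚ] K) := Finite.one_lt_card_iff_nontrivial.mp (by rw [hcard]; decide)
      exact exists_ne 1
    obtain ⟨ε₀, κ₀, lam', realisation, -, -, -, -, -, -, -, hDLR, hJ, -, hV⟩ :=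
      hBES W K Dt β ι hX hmult hsurj hram htam hK hodd hH hLt h3 hβ hc c hc1
    exact kolyvaginClass_one_ne_zero_of_definiteColumnFirstFloor W K Dt β ι c hK (algEquiv_mul_self_eq_one K hK c)
      realisation (Method2StubA.stub_levelRaisingAtThree W K Dt β ι hX hmult hsurj hram htam hK hodd hH hLt h3 hβ hc c hc1)
      hDLR hJ hV h1
  · -- S2-KS: the datum at `c`, with its definite conductor-one column, is a level Kolyvagin system
    intro W _ _ _ K _ _ Dt β ι hX hmult hsurj hram htam hK hodd hH hLt h3 hβ hc c hc1 _
    obtain ⟨ε₀, κ₀, lam', realisation, sign, selmer_off, ordinary_on, transverse_on, relation, lawA', lawB', hDLR, hJ,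
      hB0, hV⟩ := hBES W K Dt β ι hX hmult hsurj hram htam hK hodd hH hLt h3 hβ hc c hc1
    exact stub_levelKolyvaginSystemsAtThree_of_bipartite_definiteColumn W K Dt β ι hX hmult hsurj hram htam hK hodd hH hLt
      h3 hβ hc c hc1 ε₀ κ₀ lam' realisation sign selmer_off ordinary_on transverse_on relation lawA' lawB' hDLR hJ hB0 hV

end Summit.BirchSwinnertonDyer.Rank1Residual.X11b.Three.Koly.Method2Bipartite

end
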